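import Literature.Probability.RandomPlanarGeometry.RadoConvergenceProofs
import HarnessLib

/-!
# The Carathéodory kernel theorem, pointwise form for the inverse maps

Ch. Pommerenke, *Boundary Behaviour of Conformal Maps* (Springer 1992), §1.4 (book pp. 13–15),
**Theorem 1.8** (Carathéodory 1912): let `f_n` map `𝔻` conformally onto `G_n` with
`f_n(0) = w₀`, `f_n'(0) > 0`, and let `f` map `𝔻` conformally onto the kernel `G` with
`f(0) = w₀`, `f'(0) > 0`; then `f_n → f` locally uniformly in `𝔻` iff `G_n → G` with respect to
`w₀` in the sense of kernel convergence, i.e. (p. 13) (i) some neighbourhood of every `w ∈ G`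
lies in `G_n` for large `n`, and (ii) for `w ∈ ∂G` there exist `w_n ∈ ∂G_n` with `w_n → w`.

This file proves the direction (b) "`G_n → G` ⇒ `f_n → f`" in the form in which it is used to
transport scaling limits of lattice models between a planar domain and its inner/outer
approximations (Exercises 1.4.1–2, p. 15: an increasing sequence of domains converges to its
union; a decreasing sequence converges to the open kernel of its intersection), and for the
INVERSE maps `φ_n = f_n⁻¹ : G_n → 𝔻`, pointwise with derivatives:

* hypotheses: the `G_n` are open and lie in one disc (so `(f_n)` is normal — Pommerenke derives
  normality from `G ≠ ℂ` and Koebe's theorem; in the bounded situation needed downstream this is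
  immediate), (K1) = (i): every compact `K ⊆ G` lies in `G_n` for large `n`, and (K2): for every
  `p ∉ G` and `r > 0`, the disc `D(p, r)` is NOT contained in `G_n` for large `n` — this is
  (ii) for `p ∈ ∂G`, and off `Ḡ` a harmless strengthening of kernel convergence which holds in
  the two situations of Exercises 1.4.1–2 (it forces the kernel of every subsequence to be `G`);
* conclusion (`CaratheodoryKernel.tendsto_apply`, `CaratheodoryKernel.tendsto_deriv`): for the
  Riemann maps `φ_n : G_n → 𝔻`, `φ : G → 𝔻` normalised by `φ_n(z₀) = φ(z₀) = 0`, `φ_n'(z₀) > 0`,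
  `φ'(z₀) > 0`, and every `w ∈ G`: `φ_n(w) → φ(w)` and `φ_n'(w) → φ'(w)`.

Proof (Pommerenke's method of normal families, pp. 14–15, with the maximum modulus principle in
place of Rouché's theorem): by Montel's theorem every subsequence of `f_n = φ_n⁻¹` has a locally
uniformly convergent subsequence `f_{m_j} → h`; `h'(0) ≥ ρ₀ > 0` (Schwarz lemma for `φ_n` on a
disc `D(w₀, ρ₀) ⊆ G_n`), so `h` is univalent (Hurwitz); `h(𝔻) ⊆ G` by (K2) and the covering
criterion (`D(h(ζ), ρ) ⊆ f_{m_j}(𝔻) = G_{m_j}` for large `j`, part (a) of Pommerenke's proof);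
`G ⊆ h(𝔻)`: for `w ∈ G` join `w₀` to `w` by a path, thicken it to a connected open `V ⋐ G`, so
`V ⊆ G_{m_j}` for large `j` by (K1), and apply Montel's theorem to the bounded maps `φ_{m_j}` on
`V`: a limit `Ψ` has `Ψ(w₀) = 0`, hence `|Ψ(w)| < 1` by the maximum modulus principle, and
`h(Ψ(w)) = lim f_{m_j}(φ_{m_j}(w)) = w`; so `h : 𝔻 → G` is a normalised Riemann map and `h = f`
(uniqueness). Numeric limits follow by the subsequence principle; `φ_n(w) → φ(w)` is the same
Montel-on-`V` argument with `h = f`, and `φ_n' = 1 / (f_n' ∘ φ_n)`.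

## Main statements

* `CaratheodoryKernel.ball_subset_image_closedBall`: covering criterion (maximum modulus).
* `CaratheodoryKernel.exists_eventually_ball_subset_image`: locally uniform limits of holomorphic
  maps eventually cover a fixed disc about `f(c)`, `f` univalent (proof of Thm. 1.8 (a)).
* `CaratheodoryKernel.eqOn_of_tendstoLocallyUniformlyOn`: subsequential limits are the Riemann
  map of the kernel (Thm. 1.8 (b)).
* `CaratheodoryKernel.tendsto_apply`, `CaratheodoryKernel.tendsto_deriv`: pointwise convergence of
  `φ_n`, `φ_n'` on `G`.

## References

* Ch. Pommerenke, *Boundary Behaviour of Conformal Maps*, Grundlehren 299, Springer (1992), §1.4,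
  Thm. 1.8 and Exercises 1.4.1–2 (book pp. 13–15). [`PommerenkeBBCM1992`]
* C. Carathéodory, *Untersuchungen über die konformen Abbildungen von festen und veränderlichen
  Gebieten*, Math. Ann. 72 (1912), 107–144.
-/

noncomputable section

open Set Filter Metric Bornology Function
open _root_.Topology _root_.Complex

namespace Literature.Probability.RandomPlanarGeometry

namespace CaratheodoryKernel

/-! ### § 1. The covering criterion and its uniform version -/

/-- **Covering criterion** (maximum modulus; the mechanism of Rouché's theorem in Pommerenke's
proof of Thm. 1.8 (a)): if `f` is holomorphic on `U ⊇ D̄(c, r)`, `r > 0`, and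
`|f(ζ) - f(c)| ≥ m` for `|ζ - c| = r`, then every `w` with `|w - f(c)| < m/2` is a value of `f`
on `D̄(c, r)`: otherwise `1/(f - w)` has modulus `1/|f(c) - w| > 1/(m - |w - f(c)|)` at `c` but
`≤ 1/(m - |w - f(c)|)` on `|ζ - c| = r`. [cite: PommerenkeBBCM1992, Thm. 1.8 (proof, part (a))] -/
theorem ball_subset_image_closedBall {f : ℂ → ℂ} {U : Set ℂ} {c : ℂ} {r m : ℝ}
    (hf : DifferentiableOn ℂ f U) (hcr : closedBall c r ⊆ U) (hr : 0 < r)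
    (hm : ∀ ζ : ℂ, ‖ζ - c‖ = r → m ≤ ‖f ζ - f c‖) :
    ball (f c) (m / 2) ⊆ f '' closedBall c r := by
  intro w hw
  rw [mem_ball, dist_eq_norm] at hw
  by_contra hnot
  have hne : ∀ ζ ∈ closedBall c r, f ζ - w ≠ 0 := fun ζ hζ h0 ↦ hnot ⟨ζ, hζ, sub_eq_zero.1 h0⟩
  have hw0 : f c - w ≠ 0 := hne c (mem_closedBall_self hr.le)
  have hφ : DiffContOnCl ℂ (fun ζ ↦ (f ζ - w)⁻¹) (ball c r) := by
    refine DifferentiableOn.diffContOnCl ?_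
    rw [closure_ball c hr.ne']
    exact ((hf.mono hcr).sub_const w).inv hne
  have hpos : 0 < m - ‖w - f c‖ := by linarith [norm_nonneg (w - f c)]
  have hbound : ∀ ζ ∈ frontier (ball c r), ‖(f ζ - w)⁻¹‖ ≤ (m - ‖w - f c‖)⁻¹ := by
    intro ζ hζ
    rw [frontier_ball c hr.ne', mem_sphere_iff_norm] at hζ
    have h1 : m - ‖w - f c‖ ≤ ‖f ζ - w‖ := by
      have h2 : ‖f ζ - f c‖ ≤ ‖f ζ - w‖ + ‖w - f c‖ := norm_sub_le_norm_sub_add_norm_sub _ _ _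
      linarith [hm ζ hζ]
    rw [norm_inv]
    exact inv_anti₀ hpos h1
  have hmax := Complex.norm_le_of_forall_mem_frontier_norm_le isBounded_ball hφ hbound
    (subset_closure (mem_ball_self hr))
  rw [norm_inv] at hmax
  have hwpos : 0 < ‖f c - w‖ := norm_pos_iff.2 hw0
  rw [inv_le_inv₀ hwpos hpos, norm_sub_rev (f c) w] at hmax
  linarith

/-- **Uniform covering under locally uniform convergence** (Pommerenke, proof of Thm. 1.8 (a):
"`D(w, δ) ⊆ f_n(A) ⊆ G_n` for `n ≥ n₀`"): if holomorphic `F n → f` locally uniformly on an open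
`U`, `f` injective and continuous on `U`, and `c ∈ U`, then there is `ρ > 0` with
`D(f(c), ρ) ⊆ F_n(U)` for all large `n` (with `m = min_{|ζ-c|=r} |f(ζ) - f(c)| > 0` and
`|F_n - f| < m/8` on `D̄(c, r)`, the covering criterion gives `D(F_n(c), m/4) ⊆ F_n(D̄(c, r))`,
and `D(f(c), m/8) ⊆ D(F_n(c), m/4)`). [cite: PommerenkeBBCM1992, Thm. 1.8 (proof, part (a))] -/
theorem exists_eventually_ball_subset_image {ι : Type*} {l : Filter ι} {F : ι → ℂ → ℂ}
    {f : ℂ → ℂ} {U : Set ℂ} (hU : IsOpen U) (hF : ∀ᶠ n in l, DifferentiableOn ℂ (F n) U)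
    (hf : ContinuousOn f U) (hinj : InjOn f U) (hlim : TendstoLocallyUniformlyOn F f l U)
    {c : ℂ} (hc : c ∈ U) :
    ∃ ρ > 0, ∀ᶠ n in l, ball (f c) ρ ⊆ F n '' U := by
  obtain ⟨r, hr, hrU⟩ : ∃ r > 0, closedBall c r ⊆ U := by
    obtain ⟨r₀, hr₀, h⟩ := Metric.isOpen_iff.1 hU c hc
    exact ⟨r₀ / 2, by positivity, (closedBall_subset_ball (by linarith)).trans h⟩
  -- `m = min_{|ζ - c| = r} |f ζ - f c| > 0`
  have hsne : (sphere c r).Nonempty := NormedSpace.sphere_nonempty.2 hr.le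
  have hcont : ContinuousOn (fun ζ ↦ ‖f ζ - f c‖) (sphere c r) :=
    ((hf.mono (sphere_subset_closedBall.trans hrU)).sub continuousOn_const).norm
  obtain ⟨ζ₀, hζ₀, hmin⟩ := (isCompact_sphere c r).exists_isMinOn hsne hcont
  set m := ‖f ζ₀ - f c‖ with hm_def
  have hm : 0 < m := by
    rw [hm_def, norm_pos_iff, sub_ne_zero]
    intro heq
    have hζ₀c : ζ₀ = c := hinj (hrU (sphere_subset_closedBall hζ₀)) hc heq
    rw [hζ₀c, mem_sphere, dist_self] at hζ₀
    exact hr.ne' hζ₀.symm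
  have hmle : ∀ ζ, ‖ζ - c‖ = r → m ≤ ‖f ζ - f c‖ := fun ζ hζ ↦
    (isMinOn_iff.1 hmin) ζ (mem_sphere_iff_norm.2 hζ)
  -- uniform convergence on the compact closed disc
  have hunif : TendstoUniformlyOn F f l (closedBall c r) :=
    (tendstoLocallyUniformlyOn_iff_forall_isCompact hU).1 hlim _ hrU (isCompact_closedBall c r)
  have hev : ∀ᶠ n in l, ∀ x ∈ closedBall c r, dist (f x) (F n x) < m / 8 :=
    Metric.tendstoUniformlyOn_iff.1 hunif _ (by positivity)
  refine ⟨m / 8, by positivity, ?_⟩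
  filter_upwards [hF, hev] with n hFn hn
  have h2 := hn c (mem_closedBall_self hr.le)
  rw [dist_eq_norm] at h2
  -- covering criterion for `F n` with the bound `m / 2`
  have hcov : ball (F n c) (m / 2 / 2) ⊆ F n '' closedBall c r := by
    refine ball_subset_image_closedBall hFn hrU hr fun ζ hζ ↦ ?_
    have h1 := hn ζ (mem_closedBall_iff_norm.2 hζ.le)
    rw [dist_eq_norm] at h1
    have h3 := hmle ζ hζ
    have h4 : ‖f ζ - f c‖ ≤ ‖f ζ - F n ζ‖ + ‖F n ζ - F n c‖ + ‖F n c - f c‖ := by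
      calc ‖f ζ - f c‖ = ‖(f ζ - F n ζ) + (F n ζ - F n c) + (F n c - f c)‖ := by
            congr 1; ring
        _ ≤ _ := norm_add₃_le
    rw [norm_sub_rev (F n c) (f c)] at h4
    linarith
  intro w hw
  have hw' : w ∈ ball (F n c) (m / 2 / 2) := by
    rw [mem_ball, dist_eq_norm] at hw ⊢
    calc ‖w - F n c‖ ≤ ‖w - f c‖ + ‖f c - F n c‖ := norm_sub_le_norm_sub_add_norm_sub _ _ _
      _ < m / 8 + m / 8 := add_lt_add hw h2
      _ ≤ m / 2 / 2 := by linarith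
  obtain ⟨ζ, hζ, rfl⟩ := hcov hw'
  exact ⟨ζ, hrU hζ, rfl⟩

/-! ### § 2. Inverse values along a subsequence (Montel on a thin connected neighbourhood) -/

/-- **Inverse values along a subsequence** (the surjectivity step of Pommerenke's proof of
Thm. 1.8 (b), run with Montel's theorem for the inverse maps): let `g_j : 𝔻 → G_j` be conformal
with `g_j(0) = w₀` and `g_j → h` locally uniformly on `𝔻`, and let `V` be a connected open set
with `w₀, w ∈ V ⊆ G_j` for all `j`. Then some `ζ ∈ 𝔻` has `h(ζ) = w`, and `ζ = lim g_{κ_i}⁻¹(w)`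
along a subsequence: by Montel's theorem the maps `g_j⁻¹|_V` (bounded by `1`) have a locally
uniform subsequential limit `Ψ` on `V` with `Ψ(w₀) = 0` and `|Ψ| ≤ 1`, so `|Ψ(w)| < 1` by the
maximum modulus principle on the connected `V`, and `h(Ψ(w)) = lim g_{κ_i}(g_{κ_i}⁻¹(w)) = w` by
locally uniform convergence. [cite: PommerenkeBBCM1992, Thm. 1.8 (proof, part (b))] -/
theorem exists_mem_ball_tendsto_symm {G : ℕ → Set ℂ}
    (g : ∀ j, ConformalEquiv (ball (0 : ℂ) 1) (G j)) {h : ℂ → ℂ}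
    (hlim : TendstoLocallyUniformlyOn (fun j ↦ (g j : ℂ → ℂ)) h atTop (ball 0 1))
    {V : Set ℂ} (hVo : IsOpen V) (hVc : IsPreconnected V) (hVG : ∀ j, V ⊆ G j)
    {w₀ w : ℂ} (hw₀ : w₀ ∈ V) (hw : w ∈ V) (h0 : ∀ j, g j 0 = w₀) :
    ∃ ζ ∈ ball (0 : ℂ) 1, h ζ = w ∧ ∃ κ : ℕ → ℕ, StrictMono κ ∧
      Tendsto (fun i ↦ (g (κ i)).symm w) atTop (𝓝 ζ) := by
  have h0' : (0 : ℂ) ∈ ball (0 : ℂ) 1 := mem_ball_self one_pos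
  -- Montel for `Φ j = g_j⁻¹` on `V`, bounded by `1`
  set Φ : ℕ → ℂ → ℂ := fun j ↦ ((g j).symm : ℂ → ℂ) with hΦ_def
  have hΦd : ∀ j, DifferentiableOn ℂ (Φ j) V := fun j ↦ (g j).symm.differentiableOn.mono (hVG j)
  have hΦb : ∀ j, ∀ x ∈ V, ‖Φ j x‖ ≤ 1 := fun j x hx ↦
    (mem_ball_zero_iff.1 ((g j).symm_mapsTo (hVG j hx))).le
  obtain ⟨Ψ, κ, hκ, hΨd, hΨlim, -⟩ :=
    Complex.exists_strictMono_tendstoLocallyUniformlyOn_of_norm_le hVo hΦd hΦb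
  -- `Ψ w₀ = 0`, `|Ψ| ≤ 1` on `V`, hence `|Ψ w| < 1`
  have hΦ0 : ∀ j, Φ j w₀ = 0 := fun j ↦ by
    change (g j).symm w₀ = 0
    rw [← h0 j, (g j).symm_apply_apply h0']
  have hΨ0 : Ψ w₀ = 0 :=
    tendsto_nhds_unique (hΨlim.tendsto_at hw₀)
      (tendsto_const_nhds.congr fun i ↦ (hΦ0 (κ i)).symm)
  have hΨle : ∀ x ∈ V, ‖Ψ x‖ ≤ 1 := fun x hx ↦
    le_of_tendsto ((continuous_norm.tendsto _).comp (hΨlim.tendsto_at hx))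
      (Eventually.of_forall fun i ↦ hΦb (κ i) x hx)
  have hΨw : ‖Ψ w‖ < 1 := by
    refine (hΨle w hw).lt_of_ne fun heq ↦ ?_
    have hmax : IsMaxOn (norm ∘ Ψ) V w :=
      isMaxOn_iff.2 fun x hx ↦ by simpa only [Function.comp_apply, heq] using hΨle x hx
    have hconst := Complex.eqOn_of_isPreconnected_of_isMaxOn_norm hVc hVo hΨd hw hmax
    have h1 : Ψ w₀ = Ψ w := hconst hw₀
    rw [hΨ0] at h1
    rw [← h1, norm_zero] at heq
    exact zero_ne_one heq
  set ζ := Ψ w with hζ_def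
  have hζ : ζ ∈ ball (0 : ℂ) 1 := mem_ball_zero_iff.2 hΨw
  refine ⟨ζ, hζ, ?_, κ, hκ, hΨlim.tendsto_at hw⟩
  -- `h ζ = lim g (κ i) (Φ (κ i) w) = w`
  have hlimκ : TendstoLocallyUniformlyOn (fun i ↦ (g (κ i) : ℂ → ℂ)) h atTop (ball 0 1) :=
    Rado.tendstoLocallyUniformlyOn_comp hlim hκ.tendsto_atTop
  have hgd : ∀ᶠ i in atTop, DifferentiableOn ℂ (g (κ i) : ℂ → ℂ) (ball 0 1) :=
    Eventually.of_forall fun i ↦ (g (κ i)).differentiableOn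
  have hhc : ContinuousOn h (ball 0 1) := (hlimκ.differentiableOn hgd isOpen_ball).continuousOn
  have hxt : Tendsto (fun i ↦ Φ (κ i) w) atTop (𝓝[ball 0 1] ζ) :=
    tendsto_nhdsWithin_iff.2
      ⟨hΨlim.tendsto_at hw, Eventually.of_forall fun i ↦ (g (κ i)).symm_mapsTo (hVG _ hw)⟩
  have h1 : Tendsto (fun i ↦ (g (κ i) : ℂ → ℂ) (Φ (κ i) w)) atTop (𝓝 (h ζ)) :=
    hlimκ.tendsto_comp (hhc ζ hζ) hζ hxt
  have h2 : (fun i ↦ (g (κ i) : ℂ → ℂ) (Φ (κ i) w)) = fun _ ↦ w :=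
    funext fun i ↦ (g (κ i)).apply_symm_apply (hVG _ hw)
  rw [h2] at h1
  exact (tendsto_const_nhds_iff.1 h1).symm

/-- For an open connected `G` and `w₀, w ∈ G` there is a connected open `V` with `w₀, w ∈ V`
and `V̄` compact, `V̄ ⊆ G`: a thickening of a path from `w₀` to `w` in `G` (connected, as every
point of it is joined to the path by a disc about a point of the path). [folklore] -/
theorem exists_isPreconnected_open_closure_subset {G : Set ℂ} (hG : IsOpen G)
    (hGc : IsPreconnected G) {w₀ w : ℂ} (hw₀ : w₀ ∈ G) (hw : w ∈ G) :
    ∃ V : Set ℂ, IsOpen V ∧ IsPreconnected V ∧ w₀ ∈ V ∧ w ∈ V ∧ IsCompact (closure V) ∧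
      closure V ⊆ G := by
  have hpc : IsPathConnected G := (hG.isConnected_iff_isPathConnected).1 ⟨⟨w₀, hw₀⟩, hGc⟩
  obtain ⟨γ, hγ⟩ := hpc.joinedIn w₀ hw₀ w hw
  have hKc : IsCompact (range γ) := isCompact_range γ.continuous
  have hKG : range γ ⊆ G := by
    rintro _ ⟨t, rfl⟩
    exact hγ t
  obtain ⟨η, hη, hηG⟩ := hKc.exists_cthickening_subset_open hG hKG
  have h0 : w₀ ∈ thickening η (range γ) := self_subset_thickening hη _ ⟨0, γ.source⟩
  have hVc : IsPreconnected (thickening η (range γ)) := by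
    refine isPreconnected_of_forall w₀ fun y hy ↦ ?_
    obtain ⟨z, hz, hyz⟩ := mem_thickening_iff.1 hy
    refine ⟨ball z η ∪ range γ, union_subset (fun x hx ↦ mem_thickening_iff.2 ⟨z, hz, hx⟩)
      (self_subset_thickening hη _), Or.inr ⟨0, γ.source⟩, Or.inl hyz, ?_⟩
    exact (convex_ball z η).isPreconnected.union z (mem_ball_self hη) hz
      (isPreconnected_range γ.continuous)
  refine ⟨thickening η (range γ), isOpen_thickening, hVc, h0,
    self_subset_thickening hη _ ⟨1, γ.target⟩,
    (hKc.cthickening (r := η)).of_isClosed_subset isClosed_closure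
      (closure_thickening_subset_cthickening η _),
    (closure_thickening_subset_cthickening η _).trans hηG⟩

/-! ### § 3. Subsequential limits are the Riemann map of the kernel (Thm. 1.8 (b)) -/

variable {G : ℕ → Set ℂ} {Glim : Set ℂ}

/-- **Identification of subsequential limits** (Pommerenke's proof of Thm. 1.8 (b)). Let
`g_n : 𝔻 → G_n`, `g : 𝔻 → G` be conformal with `g_n(0) = g(0) = w₀`, `g_n'(0) > 0`, `g'(0) > 0`,
`G` open connected, (K1) every compact `K ⊆ G` lies in `G_n` for large `n`, (K2) for `p ∉ G`
and `r > 0`, `D(p, r) ⊄ G_n` for large `n`. If `g_{m_j} → h` locally uniformly on `𝔻` along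
`m_j → ∞`, then `h = g` on `𝔻`: `h'(0) ≥ ρ₀ > 0` is real (`D̄(w₀, ρ₀) ⊆ G_n` eventually and the
Schwarz lemma, `ConformalEquiv.le_norm_deriv_of_ball_subset`), so `h` is univalent with
zero-free derivative (Hurwitz); `h(𝔻) ⊆ G` by (K2), since a disc about any value `h(ζ)` lies in
`g_{m_j}(𝔻) = G_{m_j}` for large `j` (`exists_eventually_ball_subset_image`); `G ⊆ h(𝔻)` by
`exists_mem_ball_tendsto_symm` on a connected open `V ∋ w₀, w` with `V̄ ⊆ G` compact (so
`V ⊆ G_{m_j}` for large `j` by (K1)); hence `h : 𝔻 → G` is a normalised Riemann map and `h = g`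
by uniqueness (`ConformalEquiv.eqOn_of_deriv_pos`). [cite: PommerenkeBBCM1992, Thm. 1.8] -/
theorem eqOn_of_tendstoLocallyUniformlyOn (hGlim : IsOpen Glim) (hGlimc : IsPreconnected Glim)
    (hK1 : ∀ K, IsCompact K → K ⊆ Glim → ∀ᶠ n in atTop, K ⊆ G n)
    (hK2 : ∀ p ∉ Glim, ∀ r > 0, ∀ᶠ n in atTop, ¬ ball p r ⊆ G n)
    (g : ∀ n, ConformalEquiv (ball (0 : ℂ) 1) (G n))
    (glim : ConformalEquiv (ball (0 : ℂ) 1) Glim) (h0 : ∀ n, g n 0 = glim 0)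
    (hd : ∀ n, 0 < (deriv (g n) 0).re ∧ (deriv (g n) 0).im = 0)
    (hdlim : 0 < (deriv glim 0).re ∧ (deriv glim 0).im = 0)
    {m : ℕ → ℕ} (hm : Tendsto m atTop atTop) {h : ℂ → ℂ}
    (hlim : TendstoLocallyUniformlyOn (fun j ↦ (g (m j) : ℂ → ℂ)) h atTop (ball 0 1)) :
    EqOn h glim (ball 0 1) := by
  classical
  have h0' : (0 : ℂ) ∈ ball (0 : ℂ) 1 := mem_ball_self one_pos
  set w₀ := glim 0 with hw₀_def
  have hw₀ : w₀ ∈ Glim := glim.mapsTo h0'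
  have hFd : ∀ j, DifferentiableOn ℂ (g (m j) : ℂ → ℂ) (ball 0 1) := fun j ↦
    (g (m j)).differentiableOn
  have hFd' : ∀ᶠ j in atTop, DifferentiableOn ℂ (g (m j) : ℂ → ℂ) (ball 0 1) :=
    Eventually.of_forall hFd
  have hgd : DifferentiableOn ℂ h (ball 0 1) := hlim.differentiableOn hFd' isOpen_ball
  have hg0 : h 0 = w₀ :=
    tendsto_nhds_unique (hlim.tendsto_at h0')
      (tendsto_const_nhds.congr' (Eventually.of_forall fun j ↦ (h0 (m j)).symm))
  -- (E1) `D̄(w₀, ρ₀) ⊆ G_n` for large `n`, so `h'(0) ≥ ρ₀ > 0` is real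
  obtain ⟨δ, hδ, hδG⟩ := Metric.isOpen_iff.1 hGlim w₀ hw₀
  set ρ₀ : ℝ := δ / 2 with hρ₀
  have hρ₀pos : 0 < ρ₀ := by positivity
  have hK : ∀ᶠ n in atTop, closedBall w₀ ρ₀ ⊆ G n :=
    hK1 _ (isCompact_closedBall w₀ ρ₀) ((closedBall_subset_ball (by linarith)).trans hδG)
  have hder_ev : ∀ᶠ j in atTop, ρ₀ ≤ (deriv (g (m j)) 0).re := by
    filter_upwards [hm.eventually hK] with j hj
    have h1 := (g (m j)).le_norm_deriv_of_ball_subset (h0 (m j)) hρ₀pos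
      (ball_subset_closedBall.trans hj)
    rwa [Rado.norm_eq_re_of_im_eq_zero (hd (m j)).1.le (hd (m j)).2] at h1
  have hlim' : TendstoLocallyUniformlyOn (fun j ↦ deriv (g (m j))) (deriv h) atTop (ball 0 1) :=
    hlim.deriv hFd' isOpen_ball
  have hdg : Tendsto (fun j ↦ deriv (g (m j)) 0) atTop (𝓝 (deriv h 0)) := hlim'.tendsto_at h0'
  have hdg_re : ρ₀ ≤ (deriv h 0).re :=
    ge_of_tendsto ((Complex.continuous_re.tendsto _).comp hdg) hder_ev
  have hdg_im : (deriv h 0).im = 0 := by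
    have h1 : Tendsto (fun j ↦ (deriv (g (m j)) 0).im) atTop (𝓝 (deriv h 0).im) :=
      (Complex.continuous_im.tendsto _).comp hdg
    have h2 : (fun j ↦ (deriv (g (m j)) 0).im) = fun _ ↦ (0 : ℝ) := funext fun j ↦ (hd (m j)).2
    rw [h2] at h1
    exact tendsto_nhds_unique h1 tendsto_const_nhds
  have hdg_pos : 0 < (deriv h 0).re := hρ₀pos.trans_le hdg_re
  have hdg_ne : deriv h 0 ≠ 0 := fun he ↦ by
    rw [he, Complex.zero_re] at hdg_pos
    exact lt_irrefl _ hdg_pos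
  -- (E2) `h` is injective (Hurwitz) with zero-free derivative
  have hinj : InjOn h (ball 0 1) := by
    rcases Complex.exists_eqOn_const_or_injOn_of_tendstoLocallyUniformlyOn isOpen_ball
      (convex_ball _ _).isPreconnected hFd' (Eventually.of_forall fun j ↦ (g (m j)).injOn)
      hlim with ⟨c, hc⟩ | hi
    · exfalso
      apply hdg_ne
      have : h =ᶠ[𝓝 0] fun _ ↦ c :=
        Filter.eventuallyEq_of_mem (isOpen_ball.mem_nhds h0') fun z hz ↦ hc hz
      rw [this.deriv_eq, deriv_const]
    · exact hi
  have hdne : ∀ z ∈ ball (0 : ℂ) 1, deriv h z ≠ 0 := by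
    have hFdd : ∀ᶠ j in atTop, DifferentiableOn ℂ (deriv (g (m j))) (ball 0 1) :=
      Eventually.of_forall fun j ↦ ((hFd j).analyticOnNhd isOpen_ball).deriv.differentiableOn
    have h0f : ∃ᶠ j in atTop, ∀ z ∈ ball (0 : ℂ) 1, deriv (g (m j)) z ≠ 0 :=
      Eventually.frequently (Eventually.of_forall fun j z hz ↦
        ConformalEquiv.deriv_ne_zero_holds (g (m j)) isOpen_ball hz)
    rcases Complex.hurwitz_eqOn_zero_or_forall_ne_zero isOpen_ball
      (convex_ball _ _).isPreconnected hFdd hlim' h0f with he | hne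
    · exact absurd (he h0') hdg_ne
    · exact hne
  -- (E3) `h(𝔻) ⊆ G` by (K2) and the covering criterion
  have hgG : MapsTo h (ball 0 1) Glim := by
    intro ζ hζ
    by_contra hp
    obtain ⟨ρ, hρ, hev⟩ :=
      exists_eventually_ball_subset_image isOpen_ball hFd' hgd.continuousOn hinj hlim hζ
    obtain ⟨j, hj1, hj2⟩ := (hev.and (hm.eventually (hK2 _ hp ρ hρ))).exists
    exact hj2 (hj1.trans (g (m j)).bijOn.image_eq.subset)
  -- (E4) every point of `G` is attained
  have hsurj : SurjOn h (ball 0 1) Glim := by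
    intro w hw
    obtain ⟨V, hVo, hVc, hw₀V, hwV, hclVc, hclV⟩ :=
      exists_isPreconnected_open_closure_subset hGlim hGlimc hw₀ hw
    obtain ⟨J, hJ⟩ := (hm.eventually (hK1 _ hclVc hclV)).exists_forall_of_atTop
    obtain ⟨ζ, hζ, hζw, -⟩ := exists_mem_ball_tendsto_symm (G := fun i ↦ G (m (i + J)))
      (fun i ↦ g (m (i + J))) (Rado.tendstoLocallyUniformlyOn_comp hlim (tendsto_add_atTop_nat J))
      hVo hVc (fun i ↦ subset_closure.trans (hJ (i + J) (Nat.le_add_left J i))) hw₀V hwV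
      (fun i ↦ h0 _)
    exact ⟨ζ, hζ, hζw⟩
  -- (E5) `h` is the normalised Riemann map
  have hbij : BijOn h (ball 0 1) Glim := ⟨hgG, hinj, hsurj⟩
  have hinv : DifferentiableOn ℂ (invFunOn h (ball 0 1)) Glim := by
    rw [← hbij.image_eq]
    exact Complex.differentiableOn_invFunOn_image isOpen_ball hgd hinj hdne
  set gE : ConformalEquiv (ball (0 : ℂ) 1) Glim := ConformalEquiv.ofBijOn h hgd hbij hinv
    with hgE_def
  have hgEg : (gE : ℂ → ℂ) = h := rfl
  have hgE0 : gE.symm w₀ = 0 := by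
    rw [← hg0]
    exact gE.symm_apply_apply h0'
  have hf0 : glim.symm w₀ = 0 := glim.symm_apply_apply h0'
  obtain ⟨hfre, hfim⟩ := Rado.re_pos_im_zero_of_mul_eq_one hdlim.1 hdlim.2
    (glim.deriv_symm_mul_deriv isOpen_ball h0')
  have hgchain : deriv gE.symm w₀ * deriv h 0 = 1 := by
    have := gE.deriv_symm_mul_deriv isOpen_ball h0'
    rwa [hgEg, hg0] at this
  obtain ⟨hgre, hgim⟩ := Rado.re_pos_im_zero_of_mul_eq_one hdg_pos hdg_im hgchain
  have key := ConformalEquiv.eqOn_of_deriv_pos hGlim hw₀ glim.symm gE.symm hf0 hgE0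
    hfre hfim hgre hgim
  intro x hx
  have hgx : h x ∈ Glim := hgG hx
  have h1 : gE.symm (h x) = x := by
    rw [← hgEg]
    exact gE.symm_apply_apply hx
  have h2 : glim.symm (h x) = x := by rw [← key hgx, h1]
  rw [← glim.apply_symm_apply hgx, h2]

/-! ### § 4. Pointwise convergence of the inverse maps and their derivatives -/

/-- The inverse of a conformal equivalence `𝔻 → G`, `G` open, has derivative
`1 / g'(g⁻¹(w))` at `w ∈ G` (chain rule, `ConformalEquiv.deriv_symm_mul_deriv`). [folklore] -/
theorem deriv_symm_eq_inv (g : ConformalEquiv (ball (0 : ℂ) 1) Glim) {w : ℂ} (hw : w ∈ Glim) :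
    deriv g.symm w = (deriv g (g.symm w))⁻¹ := by
  have hx : g.symm w ∈ ball (0 : ℂ) 1 := g.symm_mapsTo hw
  have h1 := g.deriv_symm_mul_deriv isOpen_ball hx
  rw [g.apply_symm_apply hw] at h1
  exact eq_inv_of_mul_eq_one_left h1

/-- **Subsequence extraction** (the core of Thm. 1.8 (b), pointwise form): under the kernel
hypotheses (K1), (K2), a uniform bound `G_n ⊆ D̄(0, R)` and the normalisations
`g_n(0) = g(0) = w₀`, `g_n'(0) > 0`, `g'(0) > 0`, every subsequence `(n_s)` has a further
subsequence along which, for a given `w ∈ G`, `g_n⁻¹(w) → g⁻¹(w)` and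
`(g_n⁻¹)'(w) → (g⁻¹)'(w)`: Montel's theorem (`g_n` bounded by `R`), identification of the limit
(`eqOn_of_tendstoLocallyUniformlyOn`), the inverse values by `exists_mem_ball_tendsto_symm`, and
`(g_n⁻¹)' = 1 / (g_n' ∘ g_n⁻¹)` with the locally uniform convergence of `g_n'`.
[cite: PommerenkeBBCM1992, Thm. 1.8] -/
theorem exists_subseq_tendsto_symm (hGlim : IsOpen Glim) (hGlimc : IsPreconnected Glim)
    {R : ℝ} (hR : ∀ n, G n ⊆ closedBall 0 R)
    (hK1 : ∀ K, IsCompact K → K ⊆ Glim → ∀ᶠ n in atTop, K ⊆ G n)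
    (hK2 : ∀ p ∉ Glim, ∀ r > 0, ∀ᶠ n in atTop, ¬ ball p r ⊆ G n)
    (g : ∀ n, ConformalEquiv (ball (0 : ℂ) 1) (G n))
    (glim : ConformalEquiv (ball (0 : ℂ) 1) Glim) (h0 : ∀ n, g n 0 = glim 0)
    (hd : ∀ n, 0 < (deriv (g n) 0).re ∧ (deriv (g n) 0).im = 0)
    (hdlim : 0 < (deriv glim 0).re ∧ (deriv glim 0).im = 0) {w : ℂ} (hw : w ∈ Glim)
    (ns : ℕ → ℕ) (hns : Tendsto ns atTop atTop) :
    ∃ ms : ℕ → ℕ, Tendsto (fun i ↦ (g (ns (ms i))).symm w) atTop (𝓝 (glim.symm w)) ∧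
      Tendsto (fun i ↦ deriv (g (ns (ms i))).symm w) atTop (𝓝 (deriv glim.symm w)) := by
  classical
  have h0' : (0 : ℂ) ∈ ball (0 : ℂ) 1 := mem_ball_self one_pos
  set w₀ := glim 0 with hw₀_def
  have hw₀ : w₀ ∈ Glim := glim.mapsTo h0'
  -- Montel along `ns`
  have hFd : ∀ k, DifferentiableOn ℂ (g (ns k) : ℂ → ℂ) (ball 0 1) := fun k ↦
    (g (ns k)).differentiableOn
  have hFb : ∀ k, ∀ z ∈ ball (0 : ℂ) 1, ‖(g (ns k) : ℂ → ℂ) z‖ ≤ R := fun k z hz ↦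
    mem_closedBall_zero_iff.1 (hR _ ((g (ns k)).mapsTo hz))
  obtain ⟨h, κ, hκ, -, hlim, hlimd⟩ :=
    Complex.exists_strictMono_tendstoLocallyUniformlyOn_of_norm_le isOpen_ball hFd hFb
  have hm₁ : Tendsto (ns ∘ κ) atTop atTop := hns.comp hκ.tendsto_atTop
  have hEq : EqOn h glim (ball 0 1) :=
    eqOn_of_tendstoLocallyUniformlyOn (G := G) hGlim hGlimc hK1 hK2 g glim h0 hd hdlim hm₁ hlim
  -- inverse values at `w` along a further subsequence
  obtain ⟨V, hVo, hVc, hw₀V, hwV, hclVc, hclV⟩ :=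
    exists_isPreconnected_open_closure_subset hGlim hGlimc hw₀ hw
  obtain ⟨J, hJ⟩ := (hm₁.eventually (hK1 _ hclVc hclV)).exists_forall_of_atTop
  have hlimJ : TendstoLocallyUniformlyOn (fun i ↦ (g (ns (κ (i + J))) : ℂ → ℂ)) h atTop
      (ball 0 1) :=
    Rado.tendstoLocallyUniformlyOn_comp hlim (tendsto_add_atTop_nat J)
  obtain ⟨ζ, hζ, hζw, κ₂, hκ₂, hζt⟩ := exists_mem_ball_tendsto_symm
    (G := fun i ↦ G (ns (κ (i + J)))) (fun i ↦ g (ns (κ (i + J)))) hlimJ hVo hVc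
    (fun i ↦ subset_closure.trans (hJ (i + J) (Nat.le_add_left J i))) hw₀V hwV (fun i ↦ h0 _)
  -- `ζ = glim⁻¹ w`
  have hζeq : ζ = glim.symm w := by
    rw [← hζw, hEq hζ, glim.symm_apply_apply hζ]
  set ms : ℕ → ℕ := fun i ↦ κ (κ₂ i + J) with hms_def
  have hval : Tendsto (fun i ↦ (g (ns (ms i))).symm w) atTop (𝓝 (glim.symm w)) := by
    rw [← hζeq]
    exact hζt
  refine ⟨ms, hval, ?_⟩
  -- derivatives: `(g_n⁻¹)'(w) = 1 / g_n'(g_n⁻¹ w)` and `g_n' → glim'` locally uniformly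
  have hsub : Tendsto (fun i ↦ κ₂ i + J) atTop atTop :=
    (tendsto_add_atTop_nat J).comp hκ₂.tendsto_atTop
  have hlimd' : TendstoLocallyUniformlyOn (fun i ↦ deriv (g (ns (ms i)))) (deriv h) atTop
      (ball 0 1) :=
    Rado.tendstoLocallyUniformlyOn_comp hlimd hsub
  have hgd : DifferentiableOn ℂ h (ball 0 1) :=
    hlim.differentiableOn (Eventually.of_forall fun k ↦ hFd (κ k)) isOpen_ball
  have hdc : ContinuousOn (deriv h) (ball 0 1) :=
    (hgd.analyticOnNhd isOpen_ball).deriv.continuousOn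
  have hx : glim.symm w ∈ ball (0 : ℂ) 1 := glim.symm_mapsTo hw
  have hwn : ∀ᶠ i in atTop, w ∈ G (ns (ms i)) := by
    have h1 : ∀ᶠ n in atTop, ({w} : Set ℂ) ⊆ G n :=
      hK1 _ isCompact_singleton (singleton_subset_iff.2 hw)
    filter_upwards [(hm₁.comp hsub).eventually h1] with i hi
    exact hi (mem_singleton w)
  have hxt : Tendsto (fun i ↦ (g (ns (ms i))).symm w) atTop (𝓝[ball 0 1] (glim.symm w)) :=
    tendsto_nhdsWithin_iff.2 ⟨hval, by
      filter_upwards [hwn] with i hi using (g (ns (ms i))).symm_mapsTo hi⟩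
  have h1 : Tendsto (fun i ↦ deriv (g (ns (ms i))) ((g (ns (ms i))).symm w)) atTop
      (𝓝 (deriv h (glim.symm w))) :=
    hlimd'.tendsto_comp (hdc _ hx) hx hxt
  have hderiv_eq : deriv h (glim.symm w) = deriv glim (glim.symm w) := by
    refine Filter.EventuallyEq.deriv_eq (Filter.eventuallyEq_of_mem (isOpen_ball.mem_nhds hx) ?_)
    exact fun z hz ↦ hEq hz
  rw [hderiv_eq] at h1
  have hne : deriv glim (glim.symm w) ≠ 0 :=
    ConformalEquiv.deriv_ne_zero_holds glim isOpen_ball hx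
  have h2 := h1.inv₀ hne
  rw [← deriv_symm_eq_inv glim hw] at h2
  refine h2.congr' ?_
  filter_upwards [hwn] with i hi
  rw [deriv_symm_eq_inv (g (ns (ms i))) hi]

/-- **Carathéodory kernel theorem, pointwise form for the inverse maps — values** (Pommerenke
1992, Thm. 1.8, direction (b), with Exercises 1.4.1–2): let `G_n, G ⊆ D̄(0, R)` be open, `G`
connected, (K1) every compact `K ⊆ G` lies in `G_n` for large `n`, (K2) for `p ∉ G` and `r > 0`
the disc `D(p, r)` is not contained in `G_n` for large `n`; let `φ_n : G_n → 𝔻`, `φ : G → 𝔻`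
be the conformal maps normalised by `φ_n(z₀) = φ(z₀) = 0`, `φ_n'(z₀) > 0`, `φ'(z₀) > 0`. Then
`φ_n(w) → φ(w)` for every `w ∈ G` (every subsequence has a further subsequence along which this
holds, `exists_subseq_tendsto_symm` for `g_n = φ_n⁻¹`). [cite: PommerenkeBBCM1992, Thm. 1.8] -/
theorem tendsto_apply (hGo : ∀ n, IsOpen (G n)) (hGlim : IsOpen Glim)
    (hGlimc : IsPreconnected Glim) {R : ℝ} (hR : ∀ n, G n ⊆ closedBall 0 R)
    (hK1 : ∀ K, IsCompact K → K ⊆ Glim → ∀ᶠ n in atTop, K ⊆ G n)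
    (hK2 : ∀ p ∉ Glim, ∀ r > 0, ∀ᶠ n in atTop, ¬ ball p r ⊆ G n)
    (φ : ∀ n, ConformalEquiv (G n) (ball (0 : ℂ) 1))
    (φlim : ConformalEquiv Glim (ball (0 : ℂ) 1)) {z₀ : ℂ} (hz₀ : ∀ n, z₀ ∈ G n)
    (hz₀lim : z₀ ∈ Glim) (h0 : ∀ n, φ n z₀ = 0) (h0lim : φlim z₀ = 0)
    (hd : ∀ n, 0 < (deriv (φ n) z₀).re ∧ (deriv (φ n) z₀).im = 0)
    (hdlim : 0 < (deriv φlim z₀).re ∧ (deriv φlim z₀).im = 0) {w : ℂ} (hw : w ∈ Glim) :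
    Tendsto (fun n ↦ φ n w) atTop (𝓝 (φlim w)) ∧
      Tendsto (fun n ↦ deriv (φ n) w) atTop (𝓝 (deriv φlim w)) := by
  -- the maps `g_n = φ_n⁻¹ : 𝔻 → G_n` are normalised at `0`
  have hg0 : ∀ n, (φ n).symm 0 = φlim.symm 0 := fun n ↦ by
    have h1 : (φ n).symm (φ n z₀) = z₀ := (φ n).symm_apply_apply (hz₀ n)
    have h2 : φlim.symm (φlim z₀) = z₀ := φlim.symm_apply_apply hz₀lim
    rw [h0 n] at h1
    rw [h0lim] at h2
    rw [h1, h2]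
  have hgd : ∀ n, 0 < (deriv (φ n).symm 0).re ∧ (deriv (φ n).symm 0).im = 0 := fun n ↦ by
    have h1 := (φ n).deriv_symm_mul_deriv (hGo n) (hz₀ n)
    rw [h0 n] at h1
    exact Rado.re_pos_im_zero_of_mul_eq_one (hd n).1 (hd n).2 h1
  have hgdlim : 0 < (deriv φlim.symm 0).re ∧ (deriv φlim.symm 0).im = 0 := by
    have h1 := φlim.deriv_symm_mul_deriv hGlim hz₀lim
    rw [h0lim] at h1
    exact Rado.re_pos_im_zero_of_mul_eq_one hdlim.1 hdlim.2 h1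
  have key := fun ns hns ↦ exists_subseq_tendsto_symm (G := G) hGlim hGlimc hR hK1 hK2
    (fun n ↦ (φ n).symm) φlim.symm hg0 hgd hgdlim hw ns hns
  constructor
  · refine tendsto_of_subseq_tendsto fun ns hns ↦ ?_
    obtain ⟨ms, h1, -⟩ := key ns hns
    exact ⟨ms, h1⟩
  · refine tendsto_of_subseq_tendsto fun ns hns ↦ ?_
    obtain ⟨ms, -, h2⟩ := key ns hns
    exact ⟨ms, h2⟩

end CaratheodoryKernel

end Literature.Probability.RandomPlanarGeometry
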